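import Summits.QuantumFields.YangMills.Theorems.LuscherReductionTwistedTraceScalingBOStiffTailsRecord
import Summits.QuantumFields.YangMills.Theorems.FlatTubeReductionRecordSupportK
import Summits.QuantumFields.YangMills.Theorems.FlatTubeReductionStiffKDefs
import HarnessLib


/-!
# (B-ST) K-port, part 4: the TWO TAIL PIECES (gauge-far and shell) of the hST assembly, at a GENERAL CAP CONSTANT `K ≥ 1`
# (route `FlatTubeReduction`, crux K1 `NearFlatRatioLaw` stmt-QuantumFields-24720, line `ratepack_v2`, stub `stub_hST_A`; seat `ym-line-ftr-p1` g20; R2b1 RECORD rung — no summit statement is proved here)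

Lane A's ✓`…BOStiffTailFarRecord` §3–4, ✓`…BOStiffTailShellRecord` §2–4 and ✓`…BOStiffTailsRecord` §2 VERBATIM with the cap constant `43` of `recordChi L s 43 M β` replaced by a
parameter `K ≥ 1` (the rate twin's stub `stub_hST_A` needs `K = 42·max 1 (|Site 3 L|/7) + 1` at `s = 1/6`); the slow-window constant `517 = 12·43 + 1` becomes `12K + 1`
(✓`recordChi_support_K`):
* `eventually_sqrt_two_width_le_K`, ★★ `eventually_basedAvg_indicator_far_le_K`, ★★★ `eventually_qform_basedAvg_far_record_K` — the gauge-far tail;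
* ★★ `eventually_wilsonAction_ge_shell_K`, ★★ `eventually_qform_basedAvg_shell_le_K`, ★★★ `eventually_qform_basedAvg_shell_record_K` — the shell tail;
* ★★★ `hfar_record_K`, ★★★ `hshell_record_K` — the two tail hypotheses of ✓`…BOStiffAssembly.hST_of_pieces` for the record weight at cap constant `K`.
HONEST FRAMING: text port (slot substitution `43 ↦ K`) of lane A's bookkeeping for a stub of the crux K1 of the CONDITIONAL route R2b1 (RECORD rung); no new mathematics; not infinite volume,
not a gap, not Clay.
-/

set_option autoImplicit false

noncomputable section

open MeasureTheory Filter Topology Real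
open scoped BigOperators
open Literature.MathematicalPhysics.QuantumFieldTheory
open Literature.MathematicalPhysics.QuantumLattice

namespace Summit.QuantumFields.YangMills.Theorems.FemtoTransferGap.TwoLattice.ConstTube

open Summit.QuantumFields.YangMills.Theorems.FemtoTransferGap
open Summit.QuantumFields.YangMills.Theorems.FemtoTransferGap.TwoLattice
open Summit.QuantumFields.YangMills.Theorems.FemtoTransferGap.TwoLattice.Avg
open Summit.QuantumFields.YangMills.Theorems.FemtoTransferGap.TwoLattice.Stiff
open Summit.QuantumFields.YangMills.Theorems.FemtoTransferGap.TwoLattice.GnChart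
open Summit.QuantumFields.YangMills.Theorems.FemtoTransferGap.TwoLattice.Cov
open Summit.QuantumFields.YangMills.Theorems.FemtoTransferGap.TwoLattice.Toron
open Summit.QuantumFields.YangMills.Theorems.TwistedTraceScaling.Negative

variable {L : ℕ} [NeZero L]

/-! ## §1 The gauge-far tail -/

/-- `√2·β^{-1} ≤ (Kβ^{-s})³` and positivity, eventually (`0 < s ≤ 1/3`, `K ≥ 2`). [folklore] -/
theorem eventually_sqrt_two_width_le_K {K : ℝ} (hK : 2 ≤ K) {s : ℝ} (hs3 : s ≤ 1 / 3) :
    ∀ᶠ β : ℝ in atTop, 0 < Real.sqrt 2 * powScale 1 β ∧ Real.sqrt 2 * powScale 1 β ≤ (K * powScale s β) ^ 3 := by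
  filter_upwards [eventually_ge_atTop (1 : ℝ)] with β hβ
  have hp : 0 < powScale 1 β := powScale_pos 1 β
  refine ⟨by positivity, ?_⟩
  have h1 : powScale 1 β ≤ powScale s β ^ 3 := powScale_one_le_cube hs3 hβ
  have h2 : Real.sqrt 2 ≤ 2 := by
    rw [show (2 : ℝ) = Real.sqrt 4 by rw [show (4 : ℝ) = 2 ^ 2 by norm_num, Real.sqrt_sq (by norm_num : (0:ℝ) ≤ 2)]]
    exact Real.sqrt_le_sqrt (by norm_num)
  have hps0 : 0 ≤ powScale s β ^ 3 := pow_nonneg (powScale_pos s β).le 3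
  calc Real.sqrt 2 * powScale 1 β ≤ 2 * powScale s β ^ 3 := mul_le_mul h2 h1 hp.le (by norm_num)
    _ ≤ K ^ 3 * powScale s β ^ 3 := mul_le_mul_of_nonneg_right (hK.trans (le_self_pow₀ (by linarith) (by norm_num))) hps0
    _ = (K * powScale s β) ^ 3 := by ring

/-- ★★ **THE POINTWISE RATIO BOUND OF RECORD**: for `L` with a non-zero site and `0 < s ≤ 1/3` there is `M₀` such that for every `M ≥ M₀`, eventually in `β`, for EVERY `U`,
`P₀(𝟙_Aχ)(U) ≤ 2^{d/2+2}·e^{−ℓ²/2}·P₀χ(U)`, `χ = recordChi L s K M β`, `A = {β^{-1}ℓ < ‖P_Γ relLinkVec‖}`, `ℓ = btLog β`, `d = flatDim L`. [cite: Luscher1983, §3] -/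
theorem eventually_basedAvg_indicator_far_le_K {K : ℝ} (hK : 2 ≤ K) (hLz : Nonempty (NzSite L)) {s : ℝ} (hs : 0 < s) (hs3 : s ≤ 1 / 3) :
    ∃ M₀ : ℝ, 2 ≤ M₀ ∧ ∀ M : ℝ, M₀ ≤ M → ∀ᶠ β : ℝ in atTop, ∀ U : GaugeConfig 3 L SU2,
      ∫ h, {V : GaugeConfig 3 L SU2 | powScale 1 β * btLog β < ‖(gaugeModes L).starProjection (relLinkVec L V)‖}.indicator (recordChi L s K M β)
          (gaugeTransform (basedExt L h) U) ∂basedMeasure L ≤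
        ((2 : ℝ) ^ (flatDim L / 2 + 2 : ℝ) * Real.exp (-(1 / 2 * btLog β ^ 2))) * ∫ h, recordChi L s K M β (gaugeTransform (basedExt L h) U) ∂basedMeasure L := by
  have hK0 : 0 < K := by linarith
  have hδ0 : ∀ β, 0 < K * powScale s β := fun β => mul_pos hK0 (powScale_pos s β)
  have hδ : Tendsto (fun β => K * powScale s β) atTop (𝓝 0) := by simpa using (tendsto_powScale hs).const_mul K
  -- (P) at width `β^{-1}`
  have hsd1 : ∀ᶠ β in atTop, 0 < powScale 1 β ∧ powScale 1 β ≤ (K * powScale s β) ^ 3 := by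
    filter_upwards [eventually_sqrt_two_width_le_K hK hs3] with β h
    have h2 : 1 ≤ Real.sqrt 2 := by rw [← Real.sqrt_one]; exact Real.sqrt_le_sqrt (by norm_num)
    have hp := powScale_pos 1 β
    exact ⟨hp, le_trans (by nlinarith) h.2⟩
  obtain ⟨M₁, hM₁, H₁⟩ := fpWeight_core_constant L hLz hδ0 hδ hsd1
  -- (P) at width `√2·β^{-1}`
  obtain ⟨M₂, hM₂, H₂⟩ := fpWeight_core_constant L hLz (δg := fun b => Real.sqrt 2 * powScale 1 b) hδ0 hδ (eventually_sqrt_two_width_le_K hK hs3)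
  refine ⟨max M₁ M₂, le_max_of_le_left hM₁, fun M hM => ?_⟩
  obtain ⟨C₁, β₁, hC₁, hP₁⟩ := H₁ M (le_trans (le_max_left _ _) hM)
  obtain ⟨C₂, β₂, hC₂, hP₂⟩ := H₂ M (le_trans (le_max_right _ _) hM)
  have hδ2 : Tendsto (fun β => (K * powScale s β) ^ 2) atTop (𝓝 0) := by simpa using hδ.pow 2
  filter_upwards [eventually_ge_atTop β₁, eventually_ge_atTop β₂, eventually_mul_le_of_tendsto hδ2 C₁ (by norm_num : (0 : ℝ) < 1 / 2),
    eventually_mul_le_of_tendsto hδ2 C₂ one_pos] with β hβ1 hβ2 hCδ1 hCδ2 U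
  set Nbar := fpWeightBar L (powScale 1 β) with hNbar
  have hNbar0 : 0 < Nbar := fpWeightBar_pos L (powScale_pos 1 β)
  have hNlo : 0 < Nbar * (1 - C₁ * (K * powScale s β) ^ 2) := mul_pos hNbar0 (by linarith)
  have hτ : 0 ≤ powScale 1 β * btLog β := mul_nonneg (powScale_pos 1 β).le (zero_le_one.trans (one_le_btLog β))
  have key := basedAvg_indicator_far_le_of_sandwich (fun β => K * powScale s β) (fun b => M * (K * powScale s b)) (powScale 1)
    (τ := powScale 1 β * btLog β) (Nhi := fpWeightBar L (Real.sqrt 2 * powScale 1 β) * (1 + C₂ * (K * powScale s β) ^ 2)) hτ (powScale_pos 1 β) hNlo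
    (fun V hV => (hP₁ β hβ1 V hV).1) (fun V hV => (hP₂ β hβ2 V hV).2) U
  -- the constant: `e^{−ℓ²/2}·2^{d/2}N̄(1+C₂δ²)/(N̄(1−C₁δ²)) ≤ 2^{d/2+2}e^{−ℓ²/2}`
  have hexp : Real.exp (-((powScale 1 β * btLog β) ^ 2 / (2 * powScale 1 β ^ 2))) = Real.exp (-(1 / 2 * btLog β ^ 2)) := by
    congr 1
    have hp : powScale 1 β ≠ 0 := (powScale_pos 1 β).ne'
    field_simp
  have hconst : Real.exp (-((powScale 1 β * btLog β) ^ 2 / (2 * powScale 1 β ^ 2))) * (fpWeightBar L (Real.sqrt 2 * powScale 1 β) * (1 + C₂ * (K * powScale s β) ^ 2)) /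
      (Nbar * (1 - C₁ * (K * powScale s β) ^ 2)) ≤ (2 : ℝ) ^ (flatDim L / 2 + 2 : ℝ) * Real.exp (-(1 / 2 * btLog β ^ 2)) := by
    rw [hexp, fpWeightBar_sqrt_two_mul, ← hNbar]
    have h2d : 0 < (2 : ℝ) ^ (flatDim L / 2 : ℝ) := Real.rpow_pos_of_pos (by norm_num) _
    have hsplit : (2 : ℝ) ^ (flatDim L / 2 + 2 : ℝ) = (2 : ℝ) ^ (flatDim L / 2 : ℝ) * 4 := by
      rw [Real.rpow_add (by norm_num : (0 : ℝ) < 2)]; norm_num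
    rw [hsplit, div_le_iff₀ hNlo]
    have he0 : 0 < Real.exp (-(1 / 2 * btLog β ^ 2)) := Real.exp_pos _
    -- reduce to `(1 + C₂δ²) ≤ 4(1 − C₁δ²)`
    have hineq : (1 + C₂ * (K * powScale s β) ^ 2) ≤ 4 * (1 - C₁ * (K * powScale s β) ^ 2) := by linarith
    have := mul_le_mul_of_nonneg_left hineq (le_of_lt (mul_pos (mul_pos he0 h2d) hNbar0))
    nlinarith [this]
  exact key.trans (mul_le_mul_of_nonneg_right hconst (integral_nonneg fun h => (recordChi_props (L := L) s K M β).2.2.1 _))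

set_option maxHeartbeats 800000 in
-- long record expressions.
/-- ★★★ **THE GAUGE-FAR TAIL OF RECORD IN THE CURRENCY OF `hST`**: for `L` with a non-zero site and `0 < s ≤ 1/3` there is `M₀ ≥ 2` such that for every `M ≥ M₀` and
EVERY `a > 0`, eventually in `β`, every bounded measurable `f` supported in `{recordChi L s K M β ≠ 0}` has
`⟨P₀(𝟙_A f), K_β P₀(𝟙_A f)⟩ ≤ a·Λ(β)·tubeNormSq (softWeight (recordChi L s K M β)) f`, `A = {β^{-1}ℓ < ‖P_Γ relLinkVec‖}`,
`Λ(β) = (btC/fpZ(btEps)/γ)·λ₀(L³β)`. [cite: Luscher1983, §3] [cite: SeilerLNP1982, §2] -/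
theorem eventually_qform_basedAvg_far_record_K {K : ℝ} (hK : 2 ≤ K) (hLz : Nonempty (NzSite L)) {s : ℝ} (hs : 0 < s) (hs3 : s ≤ 1 / 3) :
    ∃ M₀ : ℝ, 2 ≤ M₀ ∧ ∀ M : ℝ, M₀ ≤ M → ∀ a : ℝ, 0 < a → ∀ᶠ β : ℝ in atTop, ∀ f : GaugeConfig 3 L SU2 → ℝ, Measurable f → ∀ Cf : ℝ, (∀ U, |f U| ≤ Cf) →
      (∀ U, f U ≠ 0 → recordChi L s K M β U ≠ 0) →
      qform su2Rep β
          (fun U => ∫ h, {V : GaugeConfig 3 L SU2 | powScale 1 β * btLog β < ‖(gaugeModes L).starProjection (relLinkVec L V)‖}.indicator f (gaugeTransform (basedExt L h) U)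
            ∂basedMeasure L)
          (fun U => ∫ h, {V : GaugeConfig 3 L SU2 | powScale 1 β * btLog β < ‖(gaugeModes L).starProjection (relLinkVec L V)‖}.indicator f (gaugeTransform (basedExt L h) U)
            ∂basedMeasure L) ≤
        a * (btC L β (fun x : LinkSpace L => {x : LinkSpace L | linkCurry x ∈ capBalancedSet L}.indicator (fun _ => (1 : ℝ)) x * frozenProfile L (fun β' => stiffGaussExp L (β' / 2) β') (fun β' => min (1 / 40) (powScale (1 / 2) β' * btLog β')) β x) (btEps β) (5 * (powScale (1 / 2) β * btLog β ^ 2)) / fpZ (btEps β) / recordGamma L (fun β' => fun x : LinkSpace L => {x : LinkSpace L | linkCurry x ∈ capBalancedSet L}.indicator (fun _ => (1 : ℝ)) x * frozenProfile L (fun β'' => stiffGaussExp L (β'' / 2) β'') (fun β'' => min (1 / 40) (powScale (1 / 2) β'' * btLog β'')) β' x) β *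
          levelValue su2Rep 1 ((L : ℝ) ^ 3 * β) 0) * tubeNormSq (softWeight (recordChi L s K M β)) f := by
  obtain ⟨M₀, hM₀, H⟩ := eventually_basedAvg_indicator_far_le_K (L := L) hK hLz hs hs3
  refine ⟨M₀, hM₀, fun M hM a ha => ?_⟩
  have hP0 : (0 : ℝ) ≤ (2 : ℝ) ^ (flatDim L / 2 + 2 : ℝ) := (Real.rpow_pos_of_pos (by norm_num) _).le
  filter_upwards [H M hM, eventually_ge_atTop (0 : ℝ), eventually_tail_budget_le (L := L) (q := 1 / 2) (by norm_num) hP0 ha] with β hκ hβ hbud f hf Cf hCf hsupp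
  set A : Set (GaugeConfig 3 L SU2) := {V | powScale 1 β * btLog β < ‖(gaugeModes L).starProjection (relLinkVec L V)‖} with hAdef
  have hA : MeasurableSet A :=
    measurableSet_lt measurable_const ((gaugeModes L).starProjection.continuous.norm.measurable.comp (measurable_relLinkVec L))
  obtain ⟨hχm, hχ1, hχ0, hχc⟩ := recordChi_props (L := L) s K M β
  -- the `L²` bound of the based average of the far piece
  have hl2 := l2_basedAvg_indicator_le (L := L) hf hCf hχm hχ1 hχ0 (Real.exp_pos _) (fun U hU => (hχc U hU).1)
    (fun U hU => by by_contra hne; exact hsupp U hne hU) hA hκ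
  -- the crude kernel bound on `P₀(𝟙_A f)`
  have hCf0 : 0 ≤ Cf := (abs_nonneg _).trans (hCf 1)
  have hfA : Measurable (A.indicator f) := hf.indicator hA
  have hfAb : ∀ U, |A.indicator f U| ≤ Cf := fun U => by
    by_cases hU : U ∈ A
    · rw [Set.indicator_of_mem hU]; exact hCf U
    · rw [Set.indicator_of_notMem hU, abs_zero]; exact hCf0
  obtain ⟨hPm, hPb⟩ := basedIntegral_props (L := L) hfA hfAb
  have hq := qform_le_sup_mul_l2 β (fun U V => transferKernel_le_expCard (L := L) hβ U V) hPm hPb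
  have hl2eq : l2 (fun U => ∫ h, A.indicator f (gaugeTransform (basedExt L h) U) ∂basedMeasure L)
      (fun U => ∫ h, A.indicator f (gaugeTransform (basedExt L h) U) ∂basedMeasure L) =
      ∫ U, (∫ h, A.indicator f (gaugeTransform (basedExt L h) U) ∂basedMeasure L) ^ 2 ∂configMeasure SU2 L := by
    unfold l2; exact integral_congr_ae (ae_of_all _ fun U => by ring)
  rw [hl2eq] at hq
  have hw := integral_sq_mul_basedAvg_div_recordChi (L := L) s K M β f
  rw [hw] at hl2
  have hEK : 0 ≤ Real.exp (2 * β) ^ Fintype.card (Edge 3 L) := by positivity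
  have hT0 : 0 ≤ tubeNormSq (softWeight (recordChi L s K M β)) f :=
    integral_nonneg fun U => mul_nonneg (sq_nonneg _) ((softWeight_recordChi_props (L := L) s K M β).2.2.1 U)
  calc _ ≤ Real.exp (2 * β) ^ Fintype.card (Edge 3 L) * ∫ U, (∫ h, A.indicator f (gaugeTransform (basedExt L h) U) ∂basedMeasure L) ^ 2 ∂configMeasure SU2 L := hq
    _ ≤ Real.exp (2 * β) ^ Fintype.card (Edge 3 L) * (((2 : ℝ) ^ (flatDim L / 2 + 2 : ℝ) * Real.exp (-(1 / 2 * btLog β ^ 2))) *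
          tubeNormSq (softWeight (recordChi L s K M β)) f) := mul_le_mul_of_nonneg_left hl2 hEK
    _ = Real.exp (2 * β) ^ Fintype.card (Edge 3 L) * ((2 : ℝ) ^ (flatDim L / 2 + 2 : ℝ) * Real.exp (-(1 / 2 * btLog β ^ 2))) *
          tubeNormSq (softWeight (recordChi L s K M β)) f := by ring
    _ ≤ _ := mul_le_mul_of_nonneg_right hbud hT0

/-! ## §2 The shell tail -/

/-- ★★ **ACTION FLOOR ON THE SHELL OF RECORD**: for `L ≥ 2`, `s > 0`, `M ≥ 0` and any schedules `R₀, τ` with `2τ ≤ R₀` eventually, eventually in `β` every `U` with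
`recordChi L s K M β U ≠ 0`, `R₀ < ‖relLinkVec U‖` and `‖P_Γ(relLinkVec U)‖ ≤ τ` satisfies `(gap/16)·R₀² ≤ S(U)`, `gap = 2 − 2cos(2π/L)`. [cite: Luscher1983, §3] -/
theorem eventually_wilsonAction_ge_shell_K {K : ℝ} (hK : 1 ≤ K) (hL : 2 ≤ L) {s : ℝ} (hs : 0 < s) {M : ℝ} (hM : 0 ≤ M) (R₀ τ : ℝ → ℝ)
    (h2τ : ∀ᶠ β : ℝ in atTop, 2 * τ β ≤ R₀ β) :
    ∀ᶠ β : ℝ in atTop, ∀ U : GaugeConfig 3 L SU2, recordChi L s K M β U ≠ 0 → R₀ β < ‖relLinkVec L U‖ →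
      ‖(gaugeModes L).starProjection (relLinkVec L U)‖ ≤ τ β →
        (2 - 2 * Real.cos (2 * Real.pi / L)) / 16 * R₀ β ^ 2 ≤ wilsonAction su2Rep U := by
  set gap : ℝ := 2 - 2 * Real.cos (2 * Real.pi / L) with hgapdef
  have hgap : 0 < gap := gap_pos L hL
  set NS : ℝ := (Fintype.card (Site 3 L) : ℝ) with hNSdef
  set n : ℝ := (Fintype.card (Edge 3 L × Fin 3) : ℝ) with hndef
  set NP : ℝ := (Fintype.card (Plaquette 3 L × Fin 3) : ℝ) with hNPdef
  set P : ℝ := (Fintype.card (Plaquette 3 L) : ℝ) with hPdef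
  -- the a-priori schedules of the record support
  set τu : ℝ → ℝ := fun β => (12 * K + 1) / NS * powScale s β with hτudef
  set ρ : ℝ → ℝ := fun β => Real.sqrt n * ((M * K + (12 * K + 1) / NS) * powScale s β) with hρdef
  have hps : Tendsto (powScale s) atTop (𝓝 0) := tendsto_powScale hs
  have Tτu : Tendsto τu atTop (𝓝 0) := by simpa [hτudef] using hps.const_mul ((12 * K + 1) / NS)
  have T2 : Tendsto (fun β => 504 * τu β * Real.sqrt NP) atTop (𝓝 0) := by simpa using (Tτu.const_mul 504).mul_const (Real.sqrt NP)
  have Tρ : Tendsto ρ atTop (𝓝 0) := by simpa [hρdef] using (hps.const_mul (M * K + (12 * K + 1) / NS)).const_mul (Real.sqrt n)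
  have T5 : Tendsto (fun β => P * (1728 * powScale s β + 29376 * ρ β + 700569 * ρ β ^ 2)) atTop (𝓝 0) := by
    have h := (((hps.const_mul 1728).add (Tρ.const_mul 29376)).add ((Tρ.pow 2).const_mul 700569)).const_mul P
    have e : P * (1728 * 0 + 29376 * 0 + 700569 * 0 ^ 2) = 0 := by ring
    rw [e] at h
    exact h
  have hc2 : (0 : ℝ) < Real.sqrt gap / 8 := by positivity
  have hc5 : (0 : ℝ) < gap / 128 := by positivity
  filter_upwards [recordChi_support_K (L := L) hs hK hM, Tτu.eventually (gt_mem_nhds one_pos), T2.eventually (gt_mem_nhds hc2),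
    Tρ.eventually (gt_mem_nhds (show (0 : ℝ) < 1 / 30 by norm_num)), T5.eventually (gt_mem_nhds hc5), h2τ] with β hsupp h1 h2 h4 h5 h6 U hUχ hUR hUΓ
  have herr : P * (1728 * Real.sqrt (powScale (2 * s) β) + 29376 * ρ β + 700569 * ρ β ^ 2) ≤ gap / 128 := by rw [R59.sqrt_powScale_two_mul]; exact h5.le
  obtain ⟨hlink, -, hUT, hslow, hact, -⟩ := hsupp U hUχ
  obtain ⟨u, x, hx, rfl⟩ := hUT
  rw [slowMean_orthoTube L u hx] at hslow hact
  rw [relLinkVec_orthoTube L u hx] at hUR hUΓ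
  have hu : ∀ (k : Fin 3) (c : Fin 3), |vecPart (u (0, k)) c| ≤ τu β := fun k c => (abs_vecPart_le_norm_sub_one _ c).trans (hslow k)
  have hent : ∀ (e : Edge 3 L) (c : Fin 3), |x e c| ≤ (M * K + (12 * K + 1) / NS) * powScale s β := fun e c => by
    have h := R59.abs_entry_le_of_links hx hlink hslow e c
    linarith
  have hps0 : 0 < powScale s β := powScale_pos s β
  have hρU : ‖linkEmbed L x‖ ≤ ρ β := R59.norm_linkEmbed_le_of_entry_le (by positivity) hent
  have hR0 : 0 ≤ R₀ β := by linarith [norm_nonneg ((gaugeModes L).starProjection (linkEmbed L x))]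
  have hΓ : ‖(gaugeModes L).starProjection (linkEmbed L x)‖ ≤ ‖linkEmbed L x‖ / 2 := by linarith
  have hfloor := R59.wilsonAction_orthoTube_ge_sq hL u hx h1.le hu h2.le (powScale_le_one (by positivity) β) hact hρU h4.le herr hΓ
  have hsq : R₀ β ^ 2 ≤ ‖linkEmbed L x‖ ^ 2 := pow_le_pow_left₀ hR0 hUR.le 2
  have hg : 0 ≤ gap / 16 := by positivity
  exact (mul_le_mul_of_nonneg_left hsq hg).trans hfloor

/-- ★★ **THE SHELL TAIL, eventually in `β`, for schedules `R₀, τ` with `2τ ≤ R₀` eventually**: for every bounded measurable `f` supported in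
`{recordChi ≠ 0} ∩ {R₀ < ‖relLinkVec‖} ∩ {‖P_Γ relLinkVec‖ ≤ τ}`, `⟨P₀f, K_βP₀f⟩ ≤ (e^{2β})^{|E|}·e^{−β·(gap/16)·R₀²}·tubeNormSq (softWeight χ) f`. [cite: Luscher1983, §3] [cite: SeilerLNP1982, §3] -/
theorem eventually_qform_basedAvg_shell_le_K {K : ℝ} (hK : 1 ≤ K) (hL : 2 ≤ L) {s : ℝ} (hs : 0 < s) {M : ℝ} (hM : 0 ≤ M) (R₀ τ : ℝ → ℝ)
    (h2τ : ∀ᶠ β : ℝ in atTop, 2 * τ β ≤ R₀ β) :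
    ∀ᶠ β : ℝ in atTop, ∀ f : GaugeConfig 3 L SU2 → ℝ, Measurable f → ∀ Cf : ℝ, (∀ U, |f U| ≤ Cf) →
      (∀ U, f U ≠ 0 → recordChi L s K M β U ≠ 0 ∧ R₀ β < ‖relLinkVec L U‖ ∧ ‖(gaugeModes L).starProjection (relLinkVec L U)‖ ≤ τ β) →
      qform su2Rep β (fun U => ∫ h, f (gaugeTransform (basedExt L h) U) ∂basedMeasure L) (fun U => ∫ h, f (gaugeTransform (basedExt L h) U) ∂basedMeasure L) ≤
        Real.exp (2 * β) ^ Fintype.card (Edge 3 L) * Real.exp (-(β * ((2 - 2 * Real.cos (2 * Real.pi / L)) / 16 * R₀ β ^ 2))) *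
          tubeNormSq (softWeight (recordChi L s K M β)) f := by
  filter_upwards [eventually_ge_atTop (0 : ℝ), eventually_wilsonAction_ge_shell_K hK hL hs hM R₀ τ h2τ] with β hβ hS f hf Cf hCf hsupp
  obtain ⟨hχm, hχ1, hχ0, hχc⟩ := recordChi_props (L := L) s K M β
  have h := qform_basedAvg_le_of_action_ge hβ hf hCf hχm hχ1 hχ0 (Real.exp_pos _) (fun U hU => (hχc U hU).1)
    (fun U hU => by by_contra hne; exact (hsupp U hne).1 hU) (s := (2 - 2 * Real.cos (2 * Real.pi / L)) / 16 * R₀ β ^ 2)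
    (fun U hU => by obtain ⟨hU1, hU2, hU3⟩ := hsupp U hU; exact hS U hU1 hU2 hU3)
  rw [integral_sq_mul_basedAvg_div_recordChi] at h
  exact h

set_option maxHeartbeats 800000 in
-- long record expressions.
/-- ★★★ **THE SHELL TAIL OF RECORD IN THE CURRENCY OF `hST`**: for `L ≥ 2`, `s > 0`, `M ≥ 0` and EVERY `a > 0`, eventually in `β`, every bounded measurable `f` supported in
`{recordChi L s K M β ≠ 0} ∩ {r_f/2 < ‖relLinkVec‖} ∩ {‖P_Γ relLinkVec‖ ≤ β^{-1}ℓ}` has `⟨P₀f, K_βP₀f⟩ ≤ a·Λ(β)·tubeNormSq (softWeight (recordChi L s K M β)) f`,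
`Λ(β) = (btC/fpZ(btEps)/γ)·λ₀(L³β)` the literal currency of `recordAnalyticInput_of_hST`. [cite: Luscher1983, §3] [cite: SeilerLNP1982, §3] -/
theorem eventually_qform_basedAvg_shell_record_K {K : ℝ} (hK : 1 ≤ K) (hL : 2 ≤ L) {s : ℝ} (hs : 0 < s) {M : ℝ} (hM : 0 ≤ M) {a : ℝ} (ha : 0 < a) :
    ∀ᶠ β : ℝ in atTop, ∀ f : GaugeConfig 3 L SU2 → ℝ, Measurable f → ∀ Cf : ℝ, (∀ U, |f U| ≤ Cf) →
      (∀ U, f U ≠ 0 → recordChi L s K M β U ≠ 0 ∧ min (1 / 40) (powScale (1 / 2) β * btLog β) / 2 < ‖relLinkVec L U‖ ∧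
        ‖(gaugeModes L).starProjection (relLinkVec L U)‖ ≤ powScale 1 β * btLog β) →
      qform su2Rep β (fun U => ∫ h, f (gaugeTransform (basedExt L h) U) ∂basedMeasure L) (fun U => ∫ h, f (gaugeTransform (basedExt L h) U) ∂basedMeasure L) ≤
        a * (btC L β (fun x : LinkSpace L => {x : LinkSpace L | linkCurry x ∈ capBalancedSet L}.indicator (fun _ => (1 : ℝ)) x * frozenProfile L (fun β' => stiffGaussExp L (β' / 2) β') (fun β' => min (1 / 40) (powScale (1 / 2) β' * btLog β')) β x) (btEps β) (5 * (powScale (1 / 2) β * btLog β ^ 2)) / fpZ (btEps β) / recordGamma L (fun β' => fun x : LinkSpace L => {x : LinkSpace L | linkCurry x ∈ capBalancedSet L}.indicator (fun _ => (1 : ℝ)) x * frozenProfile L (fun β'' => stiffGaussExp L (β'' / 2) β'') (fun β'' => min (1 / 40) (powScale (1 / 2) β'' * btLog β'')) β' x) β *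
          levelValue su2Rep 1 ((L : ℝ) ^ 3 * β) 0) * tubeNormSq (softWeight (recordChi L s K M β)) f := by
  have hgap : 0 < 2 - 2 * Real.cos (2 * Real.pi / L) := gap_pos L hL
  have hq : 0 < (2 - 2 * Real.cos (2 * Real.pi / L)) / 64 := by positivity
  filter_upwards [eventually_qform_basedAvg_shell_le_K hK hL hs hM (fun β => min (1 / 40) (powScale (1 / 2) β * btLog β) / 2) (fun β => powScale 1 β * btLog β)
    eventually_two_tau_le_half_rf, eventually_shell_exponent_eq (L := L), eventually_tail_budget_le (L := L) hq zero_le_one ha] with β hsh hexp hbud f hf Cf hCf hsupp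
  have h1 := hsh f hf Cf hCf hsupp
  rw [hexp] at h1
  have hT0 : 0 ≤ tubeNormSq (softWeight (recordChi L s K M β)) f :=
    integral_nonneg fun U => mul_nonneg (sq_nonneg _) ((softWeight_recordChi_props (L := L) s K M β).2.2.1 U)
  rw [one_mul] at hbud
  exact h1.trans (mul_le_mul_of_nonneg_right hbud hT0)

/-! ## §3 ★★★ The two tail hypotheses of `hST_of_pieces` at cap constant `K` -/

set_option maxHeartbeats 800000 in
-- long record expressions.
/-- ★★★ **`hfar` OF RECORD, in the literal shape of `hST_of_pieces`** (`S₂(β) = {β^{-1}ℓ < ‖P_Γ relLinkVec‖}`, `a₂ = a·Λ(β)`): for `L` with a non-zero site and `0 < s ≤ 1/3` there is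
`M₀ ≥ 2` such that for all `M ≥ M₀`, all `a > 0`, eventually in `β`, for every predicate `Adm` and every bounded measurable `v` supported in `{recordChi L s K M β ≠ 0}` with `Adm v`,
`Q(P₀(𝟙_{S₂(β)} v)) ≤ (a·Λ(β))·tubeNormSq (softWeight (recordChi L s K M β)) v`. [cite: Luscher1983, §3] [cite: SeilerLNP1982, §2] -/
theorem hfar_record_K {K : ℝ} (hK : 2 ≤ K) (hLz : Nonempty (NzSite L)) {s : ℝ} (hs : 0 < s) (hs3 : s ≤ 1 / 3) :
    ∃ M₀ : ℝ, 2 ≤ M₀ ∧ ∀ M : ℝ, M₀ ≤ M → ∀ a : ℝ, 0 < a → ∀ᶠ β : ℝ in atTop, ∀ Adm : (GaugeConfig 3 L SU2 → ℝ) → Prop,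
      ∀ v : GaugeConfig 3 L SU2 → ℝ, Measurable v → (∃ C : ℝ, ∀ U, |v U| ≤ C) → (∀ U, v U ≠ 0 → recordChi L s K M β U ≠ 0) → Adm v →
        qform su2Rep β
            (fun U => ∫ h, {U : GaugeConfig 3 L SU2 | powScale 1 β * btLog β < ‖(gaugeModes L).starProjection (relLinkVec L U)‖}.indicator v (gaugeTransform (basedExt L h) U)
              ∂basedMeasure L)
            (fun U => ∫ h, {U : GaugeConfig 3 L SU2 | powScale 1 β * btLog β < ‖(gaugeModes L).starProjection (relLinkVec L U)‖}.indicator v (gaugeTransform (basedExt L h) U)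
              ∂basedMeasure L) ≤
          a * (btC L β (fun x : LinkSpace L => {x : LinkSpace L | linkCurry x ∈ capBalancedSet L}.indicator (fun _ => (1 : ℝ)) x * frozenProfile L (fun β' => stiffGaussExp L (β' / 2) β') (fun β' => min (1 / 40) (powScale (1 / 2) β' * btLog β')) β x) (btEps β) (5 * (powScale (1 / 2) β * btLog β ^ 2)) / fpZ (btEps β) / recordGamma L (fun β' => fun x : LinkSpace L => {x : LinkSpace L | linkCurry x ∈ capBalancedSet L}.indicator (fun _ => (1 : ℝ)) x * frozenProfile L (fun β'' => stiffGaussExp L (β'' / 2) β'') (fun β'' => min (1 / 40) (powScale (1 / 2) β'' * btLog β'')) β' x) β *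
            levelValue su2Rep 1 ((L : ℝ) ^ 3 * β) 0) * tubeNormSq (softWeight (recordChi L s K M β)) v := by
  obtain ⟨M₀, hM₀, H⟩ := eventually_qform_basedAvg_far_record_K (L := L) hK hLz hs hs3
  refine ⟨M₀, hM₀, fun M hM a ha => ?_⟩
  filter_upwards [H M hM a ha] with β hβ Adm v hv hC hsupp _
  obtain ⟨Cv, hCv⟩ := hC
  exact hβ v hv Cv hCv hsupp

set_option maxHeartbeats 800000 in
-- long record expressions.
/-- ★★★ **`hshell` OF RECORD, in the literal shape of `hST_of_pieces`** (`S₃(β) = {r_f/2 < ‖relLinkVec‖}`, `S₂(β)` as in `hfar_record_K`, `a₃ = a·Λ(β)`): for `L ≥ 2`, `s > 0`, every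
`M ≥ 0` and every `a > 0`, eventually in `β`, for every predicate `Adm` and every bounded measurable `v` supported in `{recordChi L s K M β ≠ 0}` with `Adm v`,
`Q(P₀(𝟙_{S₃(β)∖S₂(β)} v)) ≤ (a·Λ(β))·tubeNormSq (softWeight (recordChi L s K M β)) v`. [cite: Luscher1983, §3] [cite: SeilerLNP1982, §3] -/
theorem hshell_record_K {K : ℝ} (hK : 1 ≤ K) (hL : 2 ≤ L) {s : ℝ} (hs : 0 < s) {M : ℝ} (hM : 0 ≤ M) {a : ℝ} (ha : 0 < a) :
    ∀ᶠ β : ℝ in atTop, ∀ Adm : (GaugeConfig 3 L SU2 → ℝ) → Prop,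
      ∀ v : GaugeConfig 3 L SU2 → ℝ, Measurable v → (∃ C : ℝ, ∀ U, |v U| ≤ C) → (∀ U, v U ≠ 0 → recordChi L s K M β U ≠ 0) → Adm v →
        qform su2Rep β
            (fun U => ∫ h, ({U : GaugeConfig 3 L SU2 | min (1 / 40) (powScale (1 / 2) β * btLog β) / 2 < ‖relLinkVec L U‖} \
                {U : GaugeConfig 3 L SU2 | powScale 1 β * btLog β < ‖(gaugeModes L).starProjection (relLinkVec L U)‖}).indicator v (gaugeTransform (basedExt L h) U) ∂basedMeasure L)
            (fun U => ∫ h, ({U : GaugeConfig 3 L SU2 | min (1 / 40) (powScale (1 / 2) β * btLog β) / 2 < ‖relLinkVec L U‖} \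
                {U : GaugeConfig 3 L SU2 | powScale 1 β * btLog β < ‖(gaugeModes L).starProjection (relLinkVec L U)‖}).indicator v (gaugeTransform (basedExt L h) U) ∂basedMeasure L) ≤
          a * (btC L β (fun x : LinkSpace L => {x : LinkSpace L | linkCurry x ∈ capBalancedSet L}.indicator (fun _ => (1 : ℝ)) x * frozenProfile L (fun β' => stiffGaussExp L (β' / 2) β') (fun β' => min (1 / 40) (powScale (1 / 2) β' * btLog β')) β x) (btEps β) (5 * (powScale (1 / 2) β * btLog β ^ 2)) / fpZ (btEps β) / recordGamma L (fun β' => fun x : LinkSpace L => {x : LinkSpace L | linkCurry x ∈ capBalancedSet L}.indicator (fun _ => (1 : ℝ)) x * frozenProfile L (fun β'' => stiffGaussExp L (β'' / 2) β'') (fun β'' => min (1 / 40) (powScale (1 / 2) β'' * btLog β'')) β' x) β *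
            levelValue su2Rep 1 ((L : ℝ) ^ 3 * β) 0) * tubeNormSq (softWeight (recordChi L s K M β)) v := by
  obtain ⟨cΛf, Kf, hcΛf, hfloor⟩ := recordLambda_floor (L := L)
  filter_upwards [eventually_qform_basedAvg_shell_record_K (L := L) hK hL hs hM ha, hfloor] with β hβ hΛ Adm v hv hC hsupp _
  obtain ⟨Cv, hCv⟩ := hC
  set S₃ : Set (GaugeConfig 3 L SU2) := {U | min (1 / 40) (powScale (1 / 2) β * btLog β) / 2 < ‖relLinkVec L U‖} with hS₃
  set S₂ : Set (GaugeConfig 3 L SU2) := {U | powScale 1 β * btLog β < ‖(gaugeModes L).starProjection (relLinkVec L U)‖} with hS₂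
  have hmeas : MeasurableSet (S₃ \ S₂) := (measurableSet_shell_record (L := L) _).diff (measurableSet_far_record (L := L) _)
  obtain ⟨hfm, hfb⟩ := indicator_piece_props hv hCv hmeas
  have hfsupp : ∀ U, (S₃ \ S₂).indicator v U ≠ 0 → recordChi L s K M β U ≠ 0 ∧ min (1 / 40) (powScale (1 / 2) β * btLog β) / 2 < ‖relLinkVec L U‖ ∧
      ‖(gaugeModes L).starProjection (relLinkVec L U)‖ ≤ powScale 1 β * btLog β := fun U hU => by
    by_cases hmem : U ∈ S₃ \ S₂
    · rw [Set.indicator_of_mem hmem] at hU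
      exact ⟨hsupp U hU, hmem.1, not_lt.mp hmem.2⟩
    · exact absurd (Set.indicator_of_notMem hmem v) hU
  have h := hβ _ hfm Cv hfb hfsupp
  -- the currency is nonnegative (floor), so the weighted norm of the piece may be replaced by that of `v`
  have hΛ0 : 0 ≤ btC L β (fun x : LinkSpace L => {x : LinkSpace L | linkCurry x ∈ capBalancedSet L}.indicator (fun _ => (1 : ℝ)) x * frozenProfile L (fun β' => stiffGaussExp L (β' / 2) β') (fun β' => min (1 / 40) (powScale (1 / 2) β' * btLog β')) β x) (btEps β) (5 * (powScale (1 / 2) β * btLog β ^ 2)) / fpZ (btEps β) / recordGamma L (fun β' => fun x : LinkSpace L => {x : LinkSpace L | linkCurry x ∈ capBalancedSet L}.indicator (fun _ => (1 : ℝ)) x * frozenProfile L (fun β'' => stiffGaussExp L (β'' / 2) β'') (fun β'' => min (1 / 40) (powScale (1 / 2) β'' * btLog β'')) β' x) β *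
      levelValue su2Rep 1 ((L : ℝ) ^ 3 * β) 0 :=
    le_trans (mul_pos (mul_pos hcΛf (pow_pos (powScale_pos 1 β) Kf)) (pow_pos (Real.exp_pos _) _)).le hΛ
  exact h.trans (mul_le_mul_of_nonneg_left (tubeNormSq_indicator_le s K M β hv hCv (S₃ \ S₂)) (mul_nonneg ha.le hΛ0))

end Summit.QuantumFields.YangMills.Theorems.FemtoTransferGap.TwoLattice.ConstTube

end
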